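import Literature.Algebra.Homology.StrictlyPerfectVanishingBaseChange
import Literature.Algebra.Homology.KerZeroOfQuasiIsoNatural
import HarnessLib

/-!
# Cohomology and base change above the vanishing line, on the flat complex itself (Mumford AV §5 Lemma 2 + Cor. 3)

Layer `Literature/Algebra/Homology`; namespace `Literature.Algebra.Homology`; THEOREMS ONLY (★
`StrictlyPerfectVanishingBaseChange`, ★ `KerZeroOfQuasiIsoNatural`, ★ `FlatQuasiIsoBaseChange` + Mathlib; no definition, no
named fact, no instance, no notation, no `sorry`).

The DIALECT ADAPTER between the functorial base change `(B ⊗ −)K•` of ★ `FlatQuasiIsoBaseChange` (Mathlib `tensorLeft`,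
`HomologicalComplex.ExactAt`, `QuasiIso`) and the `LinearMap.baseChange` / `Function.Exact` dialect of ★
`SplitSurjectiveBaseChange` / `KernelBaseChangeDescent` / `StrictlyPerfectVanishingBaseChange`, and the transport of
«cohomology and base change» from a strictly perfect WITNESS `P• → C•` (★ `PerfectOfPseudoCoherent`) to the flat complex `C•`
one actually has (the Čech complex of a proper flat `X → Spec R` for an affine cover):

* §1 `tensorLeft_d_hom_apply`, **`exactAt_tensorLeft_iff`** — the differentials of `(B ⊗ −)K•` are `d ⊗ B`, and
  `((B ⊗ −)K•).ExactAt i ↔ Function.Exact (d^{i−1} ⊗ B) (dⁱ ⊗ B)`.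
* §2 **`function_exact_baseChange_iff_of_quasiIso`** — for a quasi-isomorphism `ψ : P• → C•` of bounded above complexes of
  FLAT modules and any `R`-algebra `B`: `P• ⊗ B` is exact in degree `i` iff `C• ⊗ B` is (Mumford §5 Lemma 2 = ★
  `quasiIso_tensorLeft_map_of_flat`, read through §1 and Mathlib `exactAt_iff_of_quasiIsoAt`).
* §3 **`exact_baseChange_of_quasiIso_of_exact_residueField`** — Mumford §5 Cor. 3 (vanishing half) ON `C•`: `R` local with
  residue field `k`, `ψ : P• → C•` a quasi-isomorphism, `P•` strictly perfect (finite projective terms) and `C•` termwise flat,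
  both zero above degree `r`; if `C• ⊗ k` is exact in every degree `i ≥ q` then `C• ⊗ B` is exact in every degree `i ≥ q` for
  EVERY `R`-algebra `B` (★ `exact_baseChange_of_exact_residueField_of_isStrictlyLE` on `P•`, transported by §2 twice).
* §4 **`range_kerSubtype_baseChange_eq_ker_of_quasiIso`** — the `H⁰` half for complexes in degrees `≥ 0` with `q = 1`: under
  the same hypotheses with `Hⁱ(C• ⊗ k) = 0` for `i ≥ 1`, for every `B` the map `B ⊗ Z⁰(C•) → B ⊗ C⁰` has range EXACTLY
  `ker (d⁰_C ⊗ B) = H⁰(C• ⊗ B)` — «every section of the fibre lifts»: `B ⊗ H⁰(C•) ↠ H⁰(C• ⊗ B)` (★ conjunct 3 on `P•` + ★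
  `kerZeroBaseChangeMap_bijective`).
* §5 `extendScalars_d_hom_apply`, **`exactAt_extendScalars_iff`** — the §1 dictionary for `ModuleCat.extendScalars f` (algebra
  structure `f.toAlgebra`), the dialect of ★ `quasiIso_extendScalars_map_of_flat` and of the affine base change of Čech
  complexes.
* §6 **`function_exact_baseChange_iff_of_linearEquiv`**, `rTensor_mem_ker_baseChange_iff` — the test algebra may be changed
  along an `R`-linear isomorphism `κ ≃ κ'` (moving `hfib` between `IsLocalRing.ResidueField R` and a geometric avatar).

Cell `hodgecm-mathlib` (D-0151), F-DAG (h2) FILE 4 (price sheet §3 F-2 (2b); consumer EGA III 4.7.1 (β): `C•` = Čech complex of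
`L^n` on `X_{A_𝔭}`, `ker d⁰_C = Γ(X_{A_𝔭}, L^n)` by ★ `Modules.kerDZeroEquiv`, `H⁰(C• ⊗ κ(𝔭)) = Γ(X_𝔭, L^n_𝔭)` by affine base
change of the Čech complex).  Count-neutral capital; HC_CM is proved only modulo the 7 printed citations until rung 0 closes;
nothing here is about HC.

## References
* [MumfordAV1970] D. Mumford, *Abelian Varieties* (1970), §5 Lemma 2 (p. 49) and Cor. 3 (p. 53).
* [Hartshorne1977] R. Hartshorne, *Algebraic Geometry*, III Thm. 12.11 (p. 290).
* A. Grothendieck, EGA III₂ (1963), 7.7.5, 7.7.10.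
-/

universe u

open CategoryTheory CategoryTheory.Limits CategoryTheory.MonoidalCategory TensorProduct Module

noncomputable section

namespace Literature.Algebra.Homology

variable {R : Type u} [CommRing R]

/-! ### §1 The dictionary `(B ⊗ −)K•` ↔ `d ⊗ B` -/

section Dictionary

variable (K : CochainComplex (ModuleCat.{u} R) ℤ) (B : Type u) [CommRing B] [Algebra R B]

/-- The differentials of `(B ⊗ −)K•` (Mathlib `tensorLeft (ModuleCat.of R B)` applied degreewise) are the base changes
`d ⊗ B` (`LinearMap.baseChange B`), on elements. [cite: MumfordAV1970, §5 Lemma 2 (p. 49)] -/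
theorem tensorLeft_d_hom_apply (i j : ℤ) (z : B ⊗[R] K.X i) :
    ((((tensorLeft (ModuleCat.of R B)).mapHomologicalComplex (ComplexShape.up ℤ)).obj K).d i j).hom z =
      (K.d i j).hom.baseChange B z := by
  rw [LinearMap.baseChange_eq_ltensor]
  rfl

/-- **`(B ⊗ −)K•` is exact in degree `i` iff `d^{i−1} ⊗ B`, `dⁱ ⊗ B` are an exact pair of linear maps.**
[cite: MumfordAV1970, §5 Lemma 2 (p. 49)] -/
theorem exactAt_tensorLeft_iff (i : ℤ) :
    (((tensorLeft (ModuleCat.of R B)).mapHomologicalComplex (ComplexShape.up ℤ)).obj K).ExactAt i ↔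
      Function.Exact ((K.d (i - 1) i).hom.baseChange B) ((K.d i (i + 1)).hom.baseChange B) := by
  rw [exactAt_iff_function_exact _ (i - 1) i (i + 1) (by omega) rfl]
  -- the terms of `(B ⊗ −)K•` are `B ⊗_R Kⁿ` and its differentials `d ⊗ B`, definitionally
  exact Iff.rfl

end Dictionary

/-! ### §2 Exactness of `K• ⊗ B` is invariant under flat quasi-isomorphism -/

section Transport

variable {P C : CochainComplex (ModuleCat.{u} R) ℤ} (ψ : P ⟶ C)

/-- **Mumford §5 Lemma 2, degreewise**: for a quasi-isomorphism `ψ : P• → C•` of bounded above complexes of FLAT modules and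
any `R`-algebra `B`, `P• ⊗ B` is exact in degree `i` iff `C• ⊗ B` is. [cite: MumfordAV1970, §5 Lemma 2 (p. 49)] -/
theorem function_exact_baseChange_iff_of_quasiIso [QuasiIso ψ] (hP : ∀ n, Module.Flat R (P.X n))
    (hC : ∀ n, Module.Flat R (C.X n)) (N : ℤ) [P.IsStrictlyLE N] [C.IsStrictlyLE N]
    (B : Type u) [CommRing B] [Algebra R B] (i : ℤ) :
    Function.Exact ((P.d (i - 1) i).hom.baseChange B) ((P.d i (i + 1)).hom.baseChange B) ↔
      Function.Exact ((C.d (i - 1) i).hom.baseChange B) ((C.d i (i + 1)).hom.baseChange B) := by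
  haveI := quasiIso_tensorLeft_map_of_flat ψ hP hC N (ModuleCat.of R B)
  rw [← exactAt_tensorLeft_iff P B i, ← exactAt_tensorLeft_iff C B i]
  exact exactAt_iff_of_quasiIsoAt
    (((tensorLeft (ModuleCat.of R B)).mapHomologicalComplex (ComplexShape.up ℤ)).map ψ) i

/-- Finite projective terms are flat. [cite: MumfordAV1970, §5 Lemma 2 (p. 49)] -/
theorem flat_X_of_finite_projective (hP : ∀ n, Module.Finite R (P.X n) ∧ Module.Projective R (P.X n)) (n : ℤ) :
    Module.Flat R (P.X n) := by
  haveI := (hP n).2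
  infer_instance

/-! ### §3 Vanishing spreads from the closed fibre, stated on the flat complex `C•` -/

/-- **COHOMOLOGY AND BASE CHANGE ABOVE THE VANISHING LINE, on the flat complex** (Mumford §5 Cor. 3 with Lemma 2; EGA III
7.7.5/7.7.10; Hartshorne III 12.11).  `R` local with residue field `k`; `ψ : P• → C•` a quasi-isomorphism with `P•` strictly
perfect (finite projective terms) and `C•` termwise flat, both zero above degree `r`.  If `C• ⊗ k` is exact in every degree
`i ≥ q`, then `C• ⊗ B` is exact in every degree `i ≥ q` for EVERY `R`-algebra `B`.
[cite: MumfordAV1970, §5 Cor. 3 (p. 53)] [cite: Hartshorne1977, III Thm. 12.11 (p. 290)] -/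
theorem exact_baseChange_of_quasiIso_of_exact_residueField [IsLocalRing R] [QuasiIso ψ] (r : ℤ) [P.IsStrictlyLE r]
    [C.IsStrictlyLE r] (hP : ∀ n, Module.Finite R (P.X n) ∧ Module.Projective R (P.X n))
    (hC : ∀ n, Module.Flat R (C.X n)) (q : ℤ)
    (hfib : ∀ i, q ≤ i → Function.Exact ((C.d (i - 1) i).hom.baseChange (IsLocalRing.ResidueField R))
      ((C.d i (i + 1)).hom.baseChange (IsLocalRing.ResidueField R)))
    (B : Type u) [CommRing B] [Algebra R B] (i : ℤ) (hi : q ≤ i) :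
    Function.Exact ((C.d (i - 1) i).hom.baseChange B) ((C.d i (i + 1)).hom.baseChange B) := by
  have hPf := flat_X_of_finite_projective hP
  have hfibP : ∀ i, q ≤ i → Function.Exact ((P.d (i - 1) i).hom.baseChange (IsLocalRing.ResidueField R))
      ((P.d i (i + 1)).hom.baseChange (IsLocalRing.ResidueField R)) :=
    fun i hi => (function_exact_baseChange_iff_of_quasiIso ψ hPf hC r _ i).2 (hfib i hi)
  exact (function_exact_baseChange_iff_of_quasiIso ψ hPf hC r B i).1
    ((exact_baseChange_of_exact_residueField_of_isStrictlyLE P r hP q hfibP).1 B i hi)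

/-! ### §4 The `H⁰` half: every section of the fibre lifts -/

/-- The inclusion `Z⁰ ↪ C⁰` intertwines `kerZeroMap ψ` and `ψ⁰`. [cite: MumfordAV1970, §5 Lemma 2 (p. 49)] -/
theorem kerSubtype_comp_kerZeroMap :
    (LinearMap.ker (C.d 0 1).hom).subtype ∘ₗ kerZeroMap ψ = (ψ.f 0).hom ∘ₗ (LinearMap.ker (P.d 0 1).hom).subtype := by
  ext v
  rfl

/-- `range (Z⁰ ⊗ B → C⁰ ⊗ B) ≤ ker (d⁰ ⊗ B)` for any complex (`d⁰ ∘ incl = 0`). [cite: MumfordAV1970, §5 Cor. 3 (p. 53)] -/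
theorem range_kerSubtype_baseChange_le_ker (K : CochainComplex (ModuleCat.{u} R) ℤ) (B : Type u) [CommRing B]
    [Algebra R B] (i j : ℤ) :
    LinearMap.range ((LinearMap.ker (K.d i j).hom).subtype.baseChange B) ≤
      LinearMap.ker ((K.d i j).hom.baseChange B) := by
  rintro _ ⟨t, rfl⟩
  rw [LinearMap.mem_ker, ← LinearMap.comp_apply, ← LinearMap.baseChange_comp, LinearMap.comp_ker_subtype,
    LinearMap.baseChange_zero, LinearMap.zero_apply]

/-- **EVERY SECTION OF THE FIBRE LIFTS** (Mumford §5 Cor. 3, `p = 1`: «if `H¹(X_y, L_y) = 0` for all `y` then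
`f_*L ⊗ k(y) → H⁰(X_y, L_y)` is an isomorphism» — surjectivity half, for every base change, on the flat complex).  `R` local
with residue field `k`; `ψ : P• → C•` a quasi-isomorphism of complexes concentrated in degrees `[0, N]`, `P•` strictly perfect,
`C•` termwise flat; if `C• ⊗ k` is exact in every degree `i ≥ 1`, then for every `R`-algebra `B` the map
`B ⊗ Z⁰(C•) → B ⊗ C⁰` has range exactly `ker (d⁰_C ⊗ B)` (`= H⁰(C• ⊗ B)`), i.e. `B ⊗ H⁰(C•) → H⁰(C• ⊗ B)` is onto.
[cite: MumfordAV1970, §5 Cor. 3 (p. 53)] [cite: Hartshorne1977, III Thm. 12.11 (p. 290)] -/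
theorem range_kerSubtype_baseChange_eq_ker_of_quasiIso [IsLocalRing R] [QuasiIso ψ] (N : ℤ) [P.IsStrictlyLE N]
    [C.IsStrictlyLE N] [P.IsStrictlyGE 0] [C.IsStrictlyGE 0]
    (hP : ∀ n, Module.Finite R (P.X n) ∧ Module.Projective R (P.X n)) (hC : ∀ n, Module.Flat R (C.X n))
    (hfib : ∀ i, 1 ≤ i → Function.Exact ((C.d (i - 1) i).hom.baseChange (IsLocalRing.ResidueField R))
      ((C.d i (i + 1)).hom.baseChange (IsLocalRing.ResidueField R)))
    (B : Type u) [CommRing B] [Algebra R B] :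
    LinearMap.range ((LinearMap.ker (C.d 0 1).hom).subtype.baseChange B) =
      LinearMap.ker ((C.d 0 1).hom.baseChange B) := by
  refine le_antisymm (range_kerSubtype_baseChange_le_ker C B 0 1) ?_
  intro w' hw'
  have hPf := flat_X_of_finite_projective hP
  have hfibP : ∀ i, 1 ≤ i → Function.Exact ((P.d (i - 1) i).hom.baseChange (IsLocalRing.ResidueField R))
      ((P.d i (i + 1)).hom.baseChange (IsLocalRing.ResidueField R)) :=
    fun i hi => (function_exact_baseChange_iff_of_quasiIso ψ hPf hC N _ i).2 (hfib i hi)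
  -- `Z⁰(P•)` commutes with base change (★ conjunct 3 at `q = 1`)
  have hPbc := ((exact_baseChange_of_exact_residueField_of_isStrictlyLE P N hP 1 hfibP).2.2 B).2
  rw [show (1 : ℤ) - 1 = 0 by omega] at hPbc
  -- pull `w'` back along the bijection `Ker(d⁰_P ⊗ B) → Ker(d⁰_C ⊗ B)`
  obtain ⟨w, hw⟩ := (kerZeroBaseChangeMap_bijective ψ B hPf hC N).2 ⟨w', hw'⟩
  have hwP : (w : B ⊗[R] P.X 0) ∈ LinearMap.range ((LinearMap.ker (P.d 0 1).hom).subtype.baseChange B) := by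
    rw [hPbc]
    exact w.2
  obtain ⟨t, ht⟩ := hwP
  refine ⟨(kerZeroMap ψ).baseChange B t, ?_⟩
  rw [← LinearMap.comp_apply, ← LinearMap.baseChange_comp, kerSubtype_comp_kerZeroMap, LinearMap.baseChange_comp,
    LinearMap.comp_apply, ht, ← coe_kerZeroBaseChangeMap_apply, hw]

end Transport

/-! ### §5 The same dictionary for extension of scalars `ModuleCat.extendScalars f` -/

section ExtendScalars

variable {S : Type u} [CommRing S] (f : R →+* S) (K : CochainComplex (ModuleCat.{u} R) ℤ)

/-- For a ring map `f : R → S` carrying the algebra structure `f.toAlgebra`, the differentials of `S ⊗_R K•` (Mathlib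
`ModuleCat.extendScalars f` degreewise — the dialect of ★ `quasiIso_extendScalars_map_of_flat` and of the affine base change
of Čech complexes) are the base changes `d ⊗ S`, on elements. [cite: MumfordAV1970, §5 Lemma 2 (p. 49)] -/
theorem extendScalars_d_hom_apply (i j : ℤ)
    (z : (((ModuleCat.extendScalars f).mapHomologicalComplex (ComplexShape.up ℤ)).obj K).X i) :
    letI := f.toAlgebra
    ((((ModuleCat.extendScalars f).mapHomologicalComplex (ComplexShape.up ℤ)).obj K).d i j).hom z =
      (K.d i j).hom.baseChange S z := by
  letI := f.toAlgebra
  rw [LinearMap.baseChange_eq_ltensor]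
  rfl

/-- **`S ⊗_R K•` (extension of scalars along `f : R → S`, algebra structure `f.toAlgebra`) is exact in degree `i` iff
`d^{i−1} ⊗ S`, `dⁱ ⊗ S` are an exact pair of linear maps.** [cite: MumfordAV1970, §5 Lemma 2 (p. 49)] -/
theorem exactAt_extendScalars_iff (i : ℤ) :
    (((ModuleCat.extendScalars f).mapHomologicalComplex (ComplexShape.up ℤ)).obj K).ExactAt i ↔
      letI := f.toAlgebra
      Function.Exact ((K.d (i - 1) i).hom.baseChange S) ((K.d i (i + 1)).hom.baseChange S) := by
  letI := f.toAlgebra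
  rw [exactAt_iff_function_exact _ (i - 1) i (i + 1) (by omega) rfl]
  -- the terms of `S ⊗_R K•` are `S ⊗_R Kⁿ` and its differentials `d ⊗ S`, definitionally
  exact Iff.rfl

end ExtendScalars

/-! ### §6 Changing the test algebra along a linear isomorphism -/

section TestAlgebra

variable {κ κ' : Type u} [CommRing κ] [Algebra R κ] [CommRing κ'] [Algebra R κ']
  {M N W : Type u} [AddCommGroup M] [Module R M] [AddCommGroup N] [Module R N] [AddCommGroup W] [Module R W]

/-- `e ⊗ 1` intertwines `d ⊗ κ` and `d ⊗ κ'` (both composites are `e ⊗ d`). [cite: MumfordAV1970, §5 Lemma 2 (p. 49)] -/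
theorem lTensor_comp_coe_rTensor (e : κ ≃ₗ[R] κ') (d : M →ₗ[R] N) :
    d.lTensor κ' ∘ₗ ((LinearEquiv.rTensor M e : κ ⊗[R] M ≃ₗ[R] κ' ⊗[R] M) : κ ⊗[R] M →ₗ[R] κ' ⊗[R] M) =
      ((LinearEquiv.rTensor N e : κ ⊗[R] N ≃ₗ[R] κ' ⊗[R] N) : κ ⊗[R] N →ₗ[R] κ' ⊗[R] N) ∘ₗ d.lTensor κ := by
  rw [LinearEquiv.coe_rTensor, LinearEquiv.coe_rTensor, LinearMap.lTensor_comp_rTensor, LinearMap.rTensor_comp_lTensor]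

/-- **Exactness of `M ⊗ κ → N ⊗ κ → W ⊗ κ` does not depend on the test algebra up to `R`-linear isomorphism**: for
`e : κ ≃ₗ[R] κ'` (e.g. `Γ(Spec k, 𝒪) ≅ k`, or two presentations of a residue field),
`Function.Exact (d ⊗ κ) (d' ⊗ κ) ↔ Function.Exact (d ⊗ κ') (d' ⊗ κ')` — how a consumer moves the fibre hypothesis `hfib` of
§3/§4 between the residue field `IsLocalRing.ResidueField R` and a geometric avatar of it. [cite: MumfordAV1970, §5 Cor. 3 (p. 53)] -/
theorem function_exact_baseChange_iff_of_linearEquiv (e : κ ≃ₗ[R] κ') (d : M →ₗ[R] N) (d' : N →ₗ[R] W) :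
    Function.Exact (d.baseChange κ) (d'.baseChange κ) ↔ Function.Exact (d.baseChange κ') (d'.baseChange κ') := by
  have h := Function.Exact.iff_of_ladder_linearEquiv (lTensor_comp_coe_rTensor e d) (lTensor_comp_coe_rTensor e d')
  -- `baseChange = lTensor` on underlying functions
  exact h.symm

/-- The same for membership in a kernel: `z ∈ ker (d ⊗ κ) ↔ (e ⊗ 1) z ∈ ker (d ⊗ κ')`. [cite: MumfordAV1970, §5 Cor. 3 (p. 53)] -/
theorem rTensor_mem_ker_baseChange_iff (e : κ ≃ₗ[R] κ') (d : M →ₗ[R] N) (z : κ ⊗[R] M) :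
    (LinearEquiv.rTensor M e) z ∈ LinearMap.ker (d.baseChange κ') ↔ z ∈ LinearMap.ker (d.baseChange κ) := by
  rw [LinearMap.mem_ker, LinearMap.mem_ker, LinearMap.baseChange_eq_ltensor, LinearMap.baseChange_eq_ltensor]
  have h := congrArg (fun g => g z) (lTensor_comp_coe_rTensor e d)
  simp only [LinearMap.coe_comp, Function.comp_apply, LinearEquiv.coe_coe] at h
  rw [h, map_eq_zero_iff _ (LinearEquiv.rTensor N e).injective]

end TestAlgebra

end Literature.Algebra.Homology

end
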